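import Summits.CriticalPhenomena.CardyFormulaZ2.Theorems.CardyBoundaryCoulombGasBoundaryDefectGaussianRStubRealisabilityPart33

/-!
# Stub `stub_realisability` of line `rainbow-monomials-in-excursion-kernels` — Part 34 (open-edge
# levels, 4/4): the two endpoints of a frozen OPEN edge carry the same prescribed level
# (crux `BoundaryDefectGaussianR`, stmt-CriticalPhenomena-14132; insertion dictionary D2)

Lemma C of the roadmap, second half (first half: Part 13, `s13_frozenConsistency`). THEOREM
(`openEdges_vertH_eq`, registered form `s13_openEdgeLevels`): for an ADMISSIBLE leg insertion `ι`
on `V` satisfying the hypotheses FLAT and CHART below, every `e ∈ openEdges (ι.model V)` has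
`vertH e.1 = vertH (edgeTip e)` (and `hv h e.1 = hv h (edgeTip e)` for every configuration `h`):
the consistency condition of `openFactor` HOLDS at every frozen open edge — open edges are never
cuts. Proof: all mentions of a point carry one level (`mention_consistent`: two darts mentioning
`x` touch it, so by the chain lemma of Part 32 they are equal, consecutive or two apart along the
cycle, and PAIR 1 / PAIR 2 of Part 33 apply), hence `vertH` is the level of ANY mention
(`vertH_eq_of_mention`); the two corners outside `V` of a pocket are mentioned together by the
pocket's dart (`vertH_pocketCorner`); an arc vertex `v` and a ghost `g = v + dir k'` are mentioned
together by the exterior dart `(v, k')`, which lies on the cycle next to the wired dart through `v`,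
on the same wired stretch (`vertH_spoke`, chain lemma at `v`).

## The hypotheses (textual forms, for the skeleton)

* `FLAT` (insertion points flat at lattice radius `sinkLegs + 3`; implied by the flatness clause of
  `stub_realisability` once `r / δ_n ≥ sinkLegs + 3`):
  `(∀ x ∈ insert ι.sink ι.source, ∃ dvec : ℤ × ℤ, (dvec = (1, 0) ∨ dvec = (-1, 0) ∨ dvec = (0, 1) ∨ dvec = (0, -1)) ∧ ∀ v : ℤ × ℤ, (v.1 - x.1) ^ 2 + (v.2 - x.2) ^ 2 ≤ ((ι.sinkLegs : ℤ) + 3) ^ 2 → (v ∈ V ↔ 0 ≤ (v.1 - x.1) * dvec.1 + (v.2 - x.2) * dvec.2))`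
* `CHART` (every boundary vertex of `V` has a half-plane / convex-corner / reflex-corner lattice
  chart on the box of radius `3`, in the coordinates of `tp_lattice_flat / convex / reflex` of the
  transport parts; eventually true for lattice approximations of a rectilinear Jordan domain):
  `(∀ u ∈ V, ∀ k : Fin 4, u + Literature.Probability.LatticeModels.CollarLegModel.dir k ∉ V → ∃ (K : Fin 4) (c₁ c₂ : ℤ), (∀ v : ℤ × ℤ, |v.1 - u.1| ≤ 3 → |v.2 - u.2| ≤ 3 → (v ∈ V ↔ c₂ ≤ v.1 * (Literature.Probability.LatticeModels.CollarLegModel.dir (K + 1)).1 + v.2 * (Literature.Probability.LatticeModels.CollarLegModel.dir (K + 1)).2)) ∨ (∀ v : ℤ × ℤ, |v.1 - u.1| ≤ 3 → |v.2 - u.2| ≤ 3 → (v ∈ V ↔ c₁ ≤ v.1 * (Literature.Probability.LatticeModels.CollarLegModel.dir K).1 + v.2 * (Literature.Probability.LatticeModels.CollarLegModel.dir K).2 ∧ c₂ ≤ v.1 * (Literature.Probability.LatticeModels.CollarLegModel.dir (K + 1)).1 + v.2 * (Literature.Probability.LatticeModels.CollarLegModel.dir (K + 1)).2)) ∨ (∀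 v : ℤ × ℤ, |v.1 - u.1| ≤ 3 → |v.2 - u.2| ≤ 3 → (v ∈ V ↔ c₂ ≤ v.1 * (Literature.Probability.LatticeModels.CollarLegModel.dir (K + 1)).1 + v.2 * (Literature.Probability.LatticeModels.CollarLegModel.dir (K + 1)).2 ∨ v.1 * (Literature.Probability.LatticeModels.CollarLegModel.dir K).1 + v.2 * (Literature.Probability.LatticeModels.CollarLegModel.dir K).2 ≤ c₁)))`
* `NoPinch` (Part 13, needed for the closed half of Lemma C; implied by CHART):
  `(∀ x y : ℤ, ((x, y) ∈ V → (x + 1, y + 1) ∈ V → (x + 1, y) ∈ V ∨ (x, y + 1) ∈ V) ∧ ((x + 1, y) ∈ V → (x, y + 1) ∈ V → (x, y) ∈ V ∨ (x + 1, y + 1) ∈ V))`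

## Why these hypotheses: two counterexamples (exact evaluation by `#eval`, this seat)

Both data are admissible with `V` lattice-connected and `ℤ² ∖ V` king-connected.
* PINCH (the closed half needs `NoPinch`). `V = {v ∈ [0,30]×[0,20] : ¬(8 ≤ v.1 ≤ 20 ∧ 6 ≤ v.2 ≤ 12)
  ∧ ¬(v.1 = 21 ∧ 13 ≤ v.2)}` (a `13 × 7` chamber joined to the outside by the diagonal pinch
  `(20,12)∼(21,13)` and the notch `{21}×[13,20]`), `ι = ⟨{(26,20)}, legs 1, sink (14,5)⟩` (data
  `(1;1)`): admissible, flat at radius `4` at both points, unique pinch square `(20,12)`, `P = 160`;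
  `(20,12) ∈ pockets`, `(21,12) ∈ arcVerts`, `(20,13) ∉ arcVerts` (met on the free stretch only),
  `(21,13), (20,12) ∈ ghosts`; the exterior edge `((20,13), E)` is frozen, not open, `(20,13)` is a
  vertex-cell and both side faces are cells, the lower one being the FREE pocket `(20,12)`: the
  consistency of `closedFactor` there depends on `h`.
* FJORD (the open half needs `CHART`, not only `NoPinch`). `V = {v ∈ [0,47]×[0,24] :
  ¬(15 ≤ v.1 ≤ 31 ∧ 9 ≤ v.2 ≤ 14) ∧ ¬(15 ≤ v.2 ∧ (v.1 = v.2 + 15 ∨ v.1 = v.2 + 16))}` (a bay joined to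
  the outside by a fjord one diagonal step wide: a staircase with unit steps, violating CHART),
  `ι = ⟨{(47,12), (24,8), (22,8)}, legs 1, 1, 1, sink (23,0)⟩` (data `(1,1,1;3)`): admissible, pinch
  free, flat at radius `6 = sinkLegs + 3` at all four points, `P = 226`; levels: sink darts
  `-3(w) → -2 → 0`, `(47,12)`: `0 → -1(w)`, `(24,8)`: `-1 → -2`, `(22,8)`: `-2 → -3(w)`, so the two
  fjord walls are wired at `-1` (east wall) and `-3` (west wall); `(30,16), (32,15) ∈ arc`,
  `(30,15)` is the pocket of the west-wall dart `((30,16), S)`, and its outer corner `(31,15)` is first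
  mentioned by the east-wall darts `((32,15), N), ((32,15), W)` at level `-1`, then by `((30,16), S)`
  at `-3`: `vertH (30,15) = -3`, `vertH (31,15) = -1`, and the ghost edge `((30,15), E)` under the
  pocket is a frozen OPEN edge whose endpoint levels differ — a cut.
Unit tests (Part 13): on the `4×2`, `6×2` boxes and an L-shape with the data `(2;2)`, `(1;1)`,
`(1,1;2)`, `(1,1,1;3)` (14 placements) both endpoints of every open edge carry the same `vertH`.
-/

namespace Summit.CriticalPhenomena.CardyFormulaZ2.Cruxes.BoundaryDefectGaussianR.RainbowMonomialsInExcursionKernels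

open Literature.Probability.LatticeModels Literature.Probability.LatticeModels.CollarLegModel

section Admissible

variable (ι : LegInsertionData) (V : Finset (ℤ × ℤ)) {d₀ : Dart} (hadm : ι.IsAdmissible V)
  (h : outDart V ι.sink = some d₀) {st : ℕ → WalkState}
  (hst : ∀ t, st t = List.foldl (fun s d => s.step (ι.startAt V d)) ι.init ((cycle V d₀).take t))

include hadm h hst in
/-- **All mentions of a point carry the same level.** With flat insertion points and local charts
at the boundary vertices, two entries of the walk mentioning the same point `x` mention it with the
same level: the two darts touch `x`, so by the chain lemma they are equal, consecutive, or two
apart along the cycle, and PAIR 1 / PAIR 2 apply. [folklore] -/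
theorem mention_consistent
    (hflat : ∀ x ∈ insert ι.sink ι.source, ∃ dvec : ℤ × ℤ,
      (dvec = (1, 0) ∨ dvec = (-1, 0) ∨ dvec = (0, 1) ∨ dvec = (0, -1)) ∧
      ∀ v : ℤ × ℤ, (v.1 - x.1) ^ 2 + (v.2 - x.2) ^ 2 ≤ ((ι.sinkLegs : ℤ) + 3) ^ 2 →
        (v ∈ V ↔ 0 ≤ (v.1 - x.1) * dvec.1 + (v.2 - x.2) * dvec.2))
    (hchart : ∀ u ∈ V, ∀ k : Fin 4, u + dir k ∉ V → ∃ (K : Fin 4) (c₁ c₂ : ℤ),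
      (∀ v : ℤ × ℤ, |v.1 - u.1| ≤ 3 → |v.2 - u.2| ≤ 3 →
        (v ∈ V ↔ c₂ ≤ v.1 * (dir (K + 1)).1 + v.2 * (dir (K + 1)).2)) ∨
      (∀ v : ℤ × ℤ, |v.1 - u.1| ≤ 3 → |v.2 - u.2| ≤ 3 →
        (v ∈ V ↔ c₁ ≤ v.1 * (dir K).1 + v.2 * (dir K).2 ∧
          c₂ ≤ v.1 * (dir (K + 1)).1 + v.2 * (dir (K + 1)).2)) ∨
      (∀ v : ℤ × ℤ, |v.1 - u.1| ≤ 3 → |v.2 - u.2| ≤ 3 →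
        (v ∈ V ↔ c₂ ≤ v.1 * (dir (K + 1)).1 + v.2 * (dir (K + 1)).2 ∨
          v.1 * (dir K).1 + v.2 * (dir K).2 ≤ c₁)))
    {x : ℤ × ℤ} {t₁ t₂ : ℕ} (ht₁ : t₁ < (cycle V d₀).length) (ht₂ : t₂ < (cycle V d₀).length)
    {v₁ v₂ : ℤ} (hm₁ : LegInsertionData.mention V x ((cycle V d₀)[t₁], st t₁, st (t₁ + 1)) = some v₁)
    (hm₂ : LegInsertionData.mention V x ((cycle V d₀)[t₂], st t₂, st (t₂ + 1)) = some v₂) :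
    v₁ = v₂ := by
  have hP := length_cycle_pos ι V hadm h
  have hx₁ := touch_of_mention V (e := ((cycle V d₀)[t₁], st t₁, st (t₁ + 1))) (by rw [hm₁]; simp)
  have hx₂ := touch_of_mention V (e := ((cycle V d₀)[t₂], st t₂, st (t₂ + 1))) (by rw [hm₂]; simp)
  simp only at hx₁ hx₂
  obtain ⟨hu₁, hg₁⟩ := cycle_getElem_exterior ι V hadm h ht₁
  obtain ⟨hu₂, hg₂⟩ := cycle_getElem_exterior ι V hadm h ht₂
  have hch := chart_of_bdry_chart hchart hu₁ hg₁ hx₁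
  rcases touch_chain hch hu₁ hg₁ hu₂ hg₂ hx₁ hx₂ with he | he | he | ⟨e₃, hu₃, hg₃, -, he⟩
  · have := se_cycle_index_inj ι V hadm h ht₁ ht₂ he
    subst this
    rw [hm₁] at hm₂
    exact Option.some.inj hm₂
  · have hidx : t₂ = (t₁ + 1) % (cycle V d₀).length :=
      se_cycle_index_inj ι V hadm h ht₂ (Nat.mod_lt _ hP)
        (by rw [he, getElem_succ_mod ι V hadm h ht₁])
    subst hidx
    exact mention_succ_eq ι V hadm h hst hflat ht₁ hm₁ hm₂
  · have hidx : t₁ = (t₂ + 1) % (cycle V d₀).length :=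
      se_cycle_index_inj ι V hadm h ht₁ (Nat.mod_lt _ hP)
        (by rw [he, getElem_succ_mod ι V hadm h ht₂])
    subst hidx
    exact (mention_succ_eq ι V hadm h hst hflat ht₂ hm₂ hm₁).symm
  · rcases he with ⟨h31, h32⟩ | ⟨h31, h32⟩
    · have h3 : e₃ = (cycle V d₀)[(t₁ + 1) % (cycle V d₀).length]'(Nat.mod_lt _ hP) := by
        rw [h31, getElem_succ_mod ι V hadm h ht₁]
      have hidx : t₂ = ((t₁ + 1) % (cycle V d₀).length + 1) % (cycle V d₀).length :=
        se_cycle_index_inj ι V hadm h ht₂ (Nat.mod_lt _ hP)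
          (by rw [h32, h3, getElem_succ_mod ι V hadm h (Nat.mod_lt _ hP)])
      subst hidx
      exact mention_succ_succ_eq ι V hadm h hst hflat ht₁ hm₁ hm₂
    · have h3 : e₃ = (cycle V d₀)[(t₂ + 1) % (cycle V d₀).length]'(Nat.mod_lt _ hP) := by
        rw [h31, getElem_succ_mod ι V hadm h ht₂]
      have hidx : t₁ = ((t₂ + 1) % (cycle V d₀).length + 1) % (cycle V d₀).length :=
        se_cycle_index_inj ι V hadm h ht₁ (Nat.mod_lt _ hP)
          (by rw [h32, h3, getElem_succ_mod ι V hadm h (Nat.mod_lt _ hP)])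
      subst hidx
      exact (mention_succ_succ_eq ι V hadm h hst hflat ht₂ hm₂ hm₁).symm

include hadm h hst in
/-- **`vertH` is the level of ANY mention** (not just the first). [folklore] -/
theorem vertH_eq_of_mention
    (hflat : ∀ x ∈ insert ι.sink ι.source, ∃ dvec : ℤ × ℤ,
      (dvec = (1, 0) ∨ dvec = (-1, 0) ∨ dvec = (0, 1) ∨ dvec = (0, -1)) ∧
      ∀ v : ℤ × ℤ, (v.1 - x.1) ^ 2 + (v.2 - x.2) ^ 2 ≤ ((ι.sinkLegs : ℤ) + 3) ^ 2 →
        (v ∈ V ↔ 0 ≤ (v.1 - x.1) * dvec.1 + (v.2 - x.2) * dvec.2))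
    (hchart : ∀ u ∈ V, ∀ k : Fin 4, u + dir k ∉ V → ∃ (K : Fin 4) (c₁ c₂ : ℤ),
      (∀ v : ℤ × ℤ, |v.1 - u.1| ≤ 3 → |v.2 - u.2| ≤ 3 →
        (v ∈ V ↔ c₂ ≤ v.1 * (dir (K + 1)).1 + v.2 * (dir (K + 1)).2)) ∨
      (∀ v : ℤ × ℤ, |v.1 - u.1| ≤ 3 → |v.2 - u.2| ≤ 3 →
        (v ∈ V ↔ c₁ ≤ v.1 * (dir K).1 + v.2 * (dir K).2 ∧
          c₂ ≤ v.1 * (dir (K + 1)).1 + v.2 * (dir (K + 1)).2)) ∨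
      (∀ v : ℤ × ℤ, |v.1 - u.1| ≤ 3 → |v.2 - u.2| ≤ 3 →
        (v ∈ V ↔ c₂ ≤ v.1 * (dir (K + 1)).1 + v.2 * (dir (K + 1)).2 ∨
          v.1 * (dir K).1 + v.2 * (dir K).2 ≤ c₁)))
    {x : ℤ × ℤ} {t : ℕ} (ht : t < (cycle V d₀).length) {v : ℤ}
    (hm : LegInsertionData.mention V x ((cycle V d₀)[t], st t, st (t + 1)) = some v) :
    (ι.collar V).vertH x = v :=
  collar_vertH_eq ι V h hst ht hm fun t' ht' v' hm' =>
    mention_consistent ι V hadm h hst hflat hchart (by omega) ht hm' hm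

include hadm h hst in
/-- **The level of a pocket corner outside `V`** is the level of the wired stretch through the
pocket's dart. [folklore] -/
theorem vertH_pocketCorner
    (hflat : ∀ x ∈ insert ι.sink ι.source, ∃ dvec : ℤ × ℤ,
      (dvec = (1, 0) ∨ dvec = (-1, 0) ∨ dvec = (0, 1) ∨ dvec = (0, -1)) ∧
      ∀ v : ℤ × ℤ, (v.1 - x.1) ^ 2 + (v.2 - x.2) ^ 2 ≤ ((ι.sinkLegs : ℤ) + 3) ^ 2 →
        (v ∈ V ↔ 0 ≤ (v.1 - x.1) * dvec.1 + (v.2 - x.2) * dvec.2))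
    (hchart : ∀ u ∈ V, ∀ k : Fin 4, u + dir k ∉ V → ∃ (K : Fin 4) (c₁ c₂ : ℤ),
      (∀ v : ℤ × ℤ, |v.1 - u.1| ≤ 3 → |v.2 - u.2| ≤ 3 →
        (v ∈ V ↔ c₂ ≤ v.1 * (dir (K + 1)).1 + v.2 * (dir (K + 1)).2)) ∨
      (∀ v : ℤ × ℤ, |v.1 - u.1| ≤ 3 → |v.2 - u.2| ≤ 3 →
        (v ∈ V ↔ c₁ ≤ v.1 * (dir K).1 + v.2 * (dir K).2 ∧
          c₂ ≤ v.1 * (dir (K + 1)).1 + v.2 * (dir (K + 1)).2)) ∨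
      (∀ v : ℤ × ℤ, |v.1 - u.1| ≤ 3 → |v.2 - u.2| ≤ 3 →
        (v ∈ V ↔ c₂ ≤ v.1 * (dir (K + 1)).1 + v.2 * (dir (K + 1)).2 ∨
          v.1 * (dir K).1 + v.2 * (dir K).2 ≤ c₁)))
    {t : ℕ} (ht : t < (cycle V d₀).length) (hw : (st (t + 1)).wired = true) {x : ℤ × ℤ}
    (hx : x ∈ SixVertex.faceCorners (gapFace (cycle V d₀)[t])) (hxV : x ∉ V) :
    (ι.collar V).vertH x = if (st t).wired = true then (st t).level else (st (t + 1)).level := by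
  have hm : LegInsertionData.mention V x ((cycle V d₀)[t], st t, st (t + 1)) ≠ none := by
    rw [Ne, mention_eq_none_iff]
    exact fun hh => hh.2 ⟨hw, hx, hxV⟩
  obtain ⟨v, hv⟩ := Option.ne_none_iff_exists'.1 hm
  rw [vertH_eq_of_mention ι V hadm h hst hflat hchart ht hv, mention_value ι V hst ht hv]

/-- Nonzero steps along a boundary stretch. [folklore] -/
theorem add_dir_ne_self (v : ℤ × ℤ) (k : Fin 4) :
    v + dir (k + 1) ≠ v ∧ v - dir (k + 1) ≠ v ∧ v + (2 : ℤ) • dir (k + 1) ≠ v ∧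
      v - (2 : ℤ) • dir (k + 1) ≠ v := by
  obtain ⟨a, b⟩ := v
  fin_cases k <;> simp [dir]

include hadm h hst in
/-- **A spoke joins an arc vertex and a ghost at the same level.** For an arc vertex `v` and a
lattice neighbour `g = v + dir k' ∉ V`: the exterior dart `(v, k')` lies on the cycle next to the
wired dart through `v` (chain lemma at `v`; a junction in between would make the footprint
straight, which it is not), on the same wired stretch, and it mentions `v` and `g` together.
[folklore] -/
theorem vertH_spoke
    (hflat : ∀ x ∈ insert ι.sink ι.source, ∃ dvec : ℤ × ℤ,
      (dvec = (1, 0) ∨ dvec = (-1, 0) ∨ dvec = (0, 1) ∨ dvec = (0, -1)) ∧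
      ∀ v : ℤ × ℤ, (v.1 - x.1) ^ 2 + (v.2 - x.2) ^ 2 ≤ ((ι.sinkLegs : ℤ) + 3) ^ 2 →
        (v ∈ V ↔ 0 ≤ (v.1 - x.1) * dvec.1 + (v.2 - x.2) * dvec.2))
    (hchart : ∀ u ∈ V, ∀ k : Fin 4, u + dir k ∉ V → ∃ (K : Fin 4) (c₁ c₂ : ℤ),
      (∀ v : ℤ × ℤ, |v.1 - u.1| ≤ 3 → |v.2 - u.2| ≤ 3 →
        (v ∈ V ↔ c₂ ≤ v.1 * (dir (K + 1)).1 + v.2 * (dir (K + 1)).2)) ∨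
      (∀ v : ℤ × ℤ, |v.1 - u.1| ≤ 3 → |v.2 - u.2| ≤ 3 →
        (v ∈ V ↔ c₁ ≤ v.1 * (dir K).1 + v.2 * (dir K).2 ∧
          c₂ ≤ v.1 * (dir (K + 1)).1 + v.2 * (dir (K + 1)).2)) ∨
      (∀ v : ℤ × ℤ, |v.1 - u.1| ≤ 3 → |v.2 - u.2| ≤ 3 →
        (v ∈ V ↔ c₂ ≤ v.1 * (dir (K + 1)).1 + v.2 * (dir (K + 1)).2 ∨
          v.1 * (dir K).1 + v.2 * (dir K).2 ≤ c₁)))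
    {v g : ℤ × ℤ} (hv : v ∈ (ι.collar V).arc) (hgV : g ∉ V) {k' : Fin 4} (hg : g = v + dir k') :
    (ι.collar V).vertH v = (ι.collar V).vertH g := by
  have hP := length_cycle_pos ι V hadm h
  obtain ⟨t, ht, hwadj, htv⟩ := (mem_collar_arc_iff ι V h hst).1 hv
  -- it suffices to find the dart `(v, k')` on the cycle, on a wired stretch
  suffices H : ∃ (t₂ : ℕ) (ht₂ : t₂ < (cycle V d₀).length), (cycle V d₀)[t₂] = (v, k') ∧
      ((st t₂).wired = true ∨ (st (t₂ + 1)).wired = true) by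
    obtain ⟨t₂, ht₂, hd, hw⟩ := H
    have hmg : LegInsertionData.mention V g ((cycle V d₀)[t₂], st t₂, st (t₂ + 1)) =
        some (if (st t₂).wired = true then (st t₂).level else (st (t₂ + 1)).level) :=
      mention_of_vertex V hw (Or.inr (by rw [hd, hg]; rfl))
    have hmv : LegInsertionData.mention V v ((cycle V d₀)[t₂], st t₂, st (t₂ + 1)) =
        some (if (st t₂).wired = true then (st t₂).level else (st (t₂ + 1)).level) :=
      mention_of_vertex V hw (Or.inl (by rw [hd]))
    rw [vertH_eq_of_mention ι V hadm h hst hflat hchart ht₂ hmv,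
      vertH_eq_of_mention ι V hadm h hst hflat hchart ht₂ hmg]
  obtain ⟨hu, hgt⟩ := cycle_getElem_exterior ι V hadm h ht
  rcases hdk : (cycle V d₀)[t] with ⟨u, k⟩
  rw [hdk] at hu hgt htv
  simp only at hu hgt htv
  subst htv
  have hx₁ : u ∈ SixVertex.faceCorners (gapFace (u, k)) := (mem_faceCorners_gapFace _ _ _).2 (Or.inl rfl)
  have hx₂ : u ∈ SixVertex.faceCorners (gapFace (u, k')) :=
    (mem_faceCorners_gapFace _ _ _).2 (Or.inl rfl)
  have hg' : u + dir k' ∉ V := hg ▸ hgV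
  have hch := chart_of_bdry_chart hchart (e := (u, k)) hu hgt hx₁
  obtain ⟨hn1, hn2, hn3, hn4⟩ := add_dir_ne_self u k
  rcases touch_chain hch (e₁ := (u, k)) (e₂ := (u, k')) hu hgt hu hg' hx₁ hx₂ with
    he | he | he | ⟨e₃, hu₃, hg₃, -, he⟩
  · exact ⟨t, ht, by rw [hdk, he], hwadj⟩
  · -- `(u, k')` is the next dart
    refine ⟨(t + 1) % (cycle V d₀).length, Nat.mod_lt _ hP,
      by rw [getElem_succ_mod ι V hadm h ht, hdk, he], ?_⟩
    obtain ⟨-, hsw⟩ := st_mod_succ ι V hadm h hst ht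
    rw [hsw]
    by_cases hw1 : (st (t + 1)).wired = true
    · exact Or.inl hw1
    · exfalso
      have hw0 : (st t).wired = true := hwadj.resolve_right hw1
      have hact : ¬ ((st (t + 1)).level = (st t).level ∧ (st (t + 1)).wired = (st t).wired) :=
        fun hs => hw1 (hs.2.trans hw0)
      obtain ⟨y, k₀, hy0, hy1, -⟩ := straight_of_active ι V hadm h hst hflat ht hact
      rw [hdk] at hy0
      obtain ⟨rfl, rfl⟩ := Prod.mk.inj hy0
      rw [getElem_succ_mod ι V hadm h ht, hdk, ← he] at hy1
      exact hn1 (Prod.mk.inj hy1).1.symm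
  · -- `(u, k')` is the previous dart
    have hpred := getElem_pred_mod ι V hadm h ht (e := (u, k')) hu (by simpa [dartTip] using hg')
      (by rw [hdk]; exact he.symm)
    refine ⟨(t + (cycle V d₀).length - 1) % (cycle V d₀).length, Nat.mod_lt _ hP, hpred, ?_⟩
    obtain ⟨-, hsw⟩ := st_mod_succ ι V hadm h hst (Nat.mod_lt (t + (cycle V d₀).length - 1) hP)
    simp only [succ_pred_mod ht] at hsw
    rw [← hsw]
    by_cases hw0 : (st t).wired = true
    · exact Or.inr hw0
    · exfalso
      have hw1 : (st (t + 1)).wired = true := hwadj.resolve_left hw0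
      have hact : ¬ ((st (t + 1)).level = (st t).level ∧ (st (t + 1)).wired = (st t).wired) :=
        fun hs => hw0 (hs.2.symm.trans hw1)
      obtain ⟨y, k₀, hy0, -, -, hy3, -⟩ := straight_of_active ι V hadm h hst hflat ht hact
      rw [hdk] at hy0
      obtain ⟨rfl, rfl⟩ := Prod.mk.inj hy0
      rw [hpred] at hy3
      exact hn2 (Prod.mk.inj hy3).1.symm
  · rcases he with ⟨h31, h32⟩ | ⟨h31, h32⟩
    · -- `(u, k')` two darts ahead
      have hlt' : (t + 1) % (cycle V d₀).length < (cycle V d₀).length := Nat.mod_lt _ hP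
      have hd2 : (cycle V d₀)[((t + 1) % (cycle V d₀).length + 1) % (cycle V d₀).length]'
          (Nat.mod_lt _ hP) = (u, k') := by
        rw [getElem_succ_mod ι V hadm h hlt', getElem_succ_mod ι V hadm h ht, hdk, ← h31, ← h32]
      refine ⟨_, Nat.mod_lt _ hP, hd2, ?_⟩
      rcases wired_three ι V hadm h hst hflat ht with ⟨z, k₀, hz0, hz2⟩ | ⟨h1w, h2w, -⟩
      · exfalso
        rw [hdk] at hz0
        obtain ⟨rfl, rfl⟩ := Prod.mk.inj hz0
        rw [hd2] at hz2
        exact hn3 (Prod.mk.inj hz2).1.symm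
      · left
        rw [h2w]
        rcases hwadj with hw0 | hw1
        · exact hw0
        · rw [← h1w]; exact hw1
    · -- `(u, k')` two darts behind
      have hs₁ := getElem_pred_mod ι V hadm h ht (e := e₃) hu₃ (by simpa [dartTip] using hg₃)
        (by rw [hdk]; exact h32.symm)
      have hlt₁ : (t + (cycle V d₀).length - 1) % (cycle V d₀).length < (cycle V d₀).length :=
        Nat.mod_lt _ hP
      have hs₂ := getElem_pred_mod ι V hadm h hlt₁ (e := (u, k')) hu (by simpa [dartTip] using hg')
        (by rw [hs₁]; exact h31.symm)
      have hlt₂ : ((t + (cycle V d₀).length - 1) % (cycle V d₀).length + (cycle V d₀).length - 1) %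
          (cycle V d₀).length < (cycle V d₀).length := Nat.mod_lt _ hP
      refine ⟨_, hlt₂, hs₂, ?_⟩
      have e1 := succ_pred_mod hlt₁
      have e2 := succ_pred_mod ht
      rcases wired_three ι V hadm h hst hflat hlt₂ with ⟨z, k₀, hz0, hz2⟩ | ⟨-, h2w, h3w⟩
      · exfalso
        rw [hs₂] at hz0
        obtain ⟨rfl, rfl⟩ := Prod.mk.inj hz0
        simp only [e1] at hz2
        simp only [e2] at hz2
        rw [hdk] at hz2
        exact (add_dir_ne_self u k').2.2.1 (Prod.mk.inj hz2).1.symm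
      · simp only [e1] at h2w h3w
        simp only [e2] at h2w h3w
        left
        rcases hwadj with hw0 | hw1
        · rw [← h2w]; exact hw0
        · rw [← h3w]; exact hw1

end Admissible

/-! ### Edges of a face -/

/-- The endpoints of an edge of a face are corners of that face. [folklore] -/
theorem endpoints_mem_faceCorners_of_mem_faceEdges {e : (ℤ × ℤ) × Bool} {f : ℤ × ℤ}
    (he : e ∈ faceEdges f) :
    e.1 ∈ SixVertex.faceCorners f ∧ SixVertex.edgeTip e ∈ SixVertex.faceCorners f := by
  obtain ⟨f₁, f₂⟩ := f
  simp only [faceEdges, Finset.mem_insert, Finset.mem_singleton] at he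
  rcases he with rfl | rfl | rfl | rfl <;> simp [SixVertex.faceCorners, SixVertex.edgeTip]

/-! ### The theorem -/

/-- **The two endpoints of a frozen open edge carry the same prescribed level.** For an
ADMISSIBLE leg insertion whose insertion points are FLAT at radius `sinkLegs + 3`, on a `V` with
LOCAL CHARTS at its boundary vertices: for every `e ∈ openEdges (ι.model V)`,
`vertH e.1 = vertH (edgeTip e)` — a spoke joins an arc vertex to a ghost at the level of their
common wired stretch (`vertH_spoke`), a pocket edge joins two ghosts at the level of the pocket's
dart (`vertH_pocketCorner`). Hence a frozen open edge is never a cut: `openFactor` is consistent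
in every configuration. [folklore] -/
theorem openEdges_vertH_eq (ι : LegInsertionData) (V : Finset (ℤ × ℤ)) (hadm : ι.IsAdmissible V)
    (hflat : ∀ x ∈ insert ι.sink ι.source, ∃ dvec : ℤ × ℤ,
      (dvec = (1, 0) ∨ dvec = (-1, 0) ∨ dvec = (0, 1) ∨ dvec = (0, -1)) ∧
      ∀ v : ℤ × ℤ, (v.1 - x.1) ^ 2 + (v.2 - x.2) ^ 2 ≤ ((ι.sinkLegs : ℤ) + 3) ^ 2 →
        (v ∈ V ↔ 0 ≤ (v.1 - x.1) * dvec.1 + (v.2 - x.2) * dvec.2))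
    (hchart : ∀ u ∈ V, ∀ k : Fin 4, u + dir k ∉ V → ∃ (K : Fin 4) (c₁ c₂ : ℤ),
      (∀ v : ℤ × ℤ, |v.1 - u.1| ≤ 3 → |v.2 - u.2| ≤ 3 →
        (v ∈ V ↔ c₂ ≤ v.1 * (dir (K + 1)).1 + v.2 * (dir (K + 1)).2)) ∨
      (∀ v : ℤ × ℤ, |v.1 - u.1| ≤ 3 → |v.2 - u.2| ≤ 3 →
        (v ∈ V ↔ c₁ ≤ v.1 * (dir K).1 + v.2 * (dir K).2 ∧
          c₂ ≤ v.1 * (dir (K + 1)).1 + v.2 * (dir (K + 1)).2)) ∨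
      (∀ v : ℤ × ℤ, |v.1 - u.1| ≤ 3 → |v.2 - u.2| ≤ 3 →
        (v ∈ V ↔ c₂ ≤ v.1 * (dir (K + 1)).1 + v.2 * (dir (K + 1)).2 ∨
          v.1 * (dir K).1 + v.2 * (dir K).2 ≤ c₁)))
    {e : (ℤ × ℤ) × Bool} (he : e ∈ (ι.model V).openEdges) :
    (ι.model V).C.vertH e.1 = (ι.model V).C.vertH (SixVertex.edgeTip e) := by
  obtain ⟨d₀, h, -, -, -, -⟩ := s3_of_admissible ι V hadm
  have hst : ∀ t, (fun t => List.foldl (fun s d => s.step (ι.startAt V d)) ι.init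
      ((cycle V d₀).take t)) t = List.foldl (fun s d => s.step (ι.startAt V d)) ι.init
      ((cycle V d₀).take t) := fun _ => rfl
  show (ι.collar V).vertH e.1 = (ι.collar V).vertH (SixVertex.edgeTip e)
  simp only [openEdges, Finset.mem_filter] at he
  obtain ⟨-, hcase⟩ := he
  have hd0 : ∀ p : ℤ × ℤ, (p.1 + 1, p.2) = p + dir 0 := fun p => by
    obtain ⟨a, b⟩ := p; simp [dir]
  have hd1 : ∀ p : ℤ × ℤ, (p.1, p.2 + 1) = p + dir 1 := fun p => by
    obtain ⟨a, b⟩ := p; simp [dir]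
  have hd2 : ∀ p : ℤ × ℤ, p = (p.1 + 1, p.2) + dir 2 := fun p => by
    obtain ⟨a, b⟩ := p; simp [dir]
  have hd3 : ∀ p : ℤ × ℤ, p = (p.1, p.2 + 1) + dir 3 := fun p => by
    obtain ⟨a, b⟩ := p; simp [dir]
  rcases hcase with ⟨hv, hg⟩ | ⟨hv, hg⟩ | ⟨h1, h2, p, hp, hep⟩
  · have hva : e.1 ∈ (ι.collar V).arc := (Finset.mem_inter.1 hv).1
    have hgV : SixVertex.edgeTip e ∉ V := (Finset.mem_sdiff.1 hg).2
    rcases edgeTip_eq_or e with ht | ht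
    · exact vertH_spoke ι V hadm h hst hflat hchart hva hgV (k' := 0) (by rw [ht, hd0])
    · exact vertH_spoke ι V hadm h hst hflat hchart hva hgV (k' := 1) (by rw [ht, hd1])
  · have hva : SixVertex.edgeTip e ∈ (ι.collar V).arc := (Finset.mem_inter.1 hv).1
    have hgV : e.1 ∉ V := (Finset.mem_sdiff.1 hg).2
    rcases edgeTip_eq_or e with ht | ht
    · exact (vertH_spoke ι V hadm h hst hflat hchart hva hgV (k' := 2) (by rw [ht]; exact hd2 _)).symm
    · exact (vertH_spoke ι V hadm h hst hflat hchart hva hgV (k' := 3) (by rw [ht]; exact hd3 _)).symm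
  · have hpC : p ∈ (ι.collar V).pocket := (Finset.mem_inter.1 hp).1
    obtain ⟨t, ht, hw, hgap⟩ := (mem_collar_pocket_iff ι V h hst).1 hpC
    obtain ⟨hc1, hc2⟩ := endpoints_mem_faceCorners_of_mem_faceEdges hep
    rw [← hgap] at hc1 hc2
    rw [vertH_pocketCorner ι V hadm h hst hflat hchart ht hw hc1 h1,
      vertH_pocketCorner ι V hadm h hst hflat hchart ht hw hc2 h2]

/-! ### Registered one-line form -/

/-- **Sub-goal `s13_openEdgeLevels`** (registered on stmt-CriticalPhenomena-14132): for an
ADMISSIBLE leg insertion `ι` on `V` whose insertion points are FLAT at radius `sinkLegs + 3`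
(hypothesis `FLAT`) and whose boundary vertices carry local half-plane / convex-corner /
reflex-corner CHARTS at radius `3` (hypothesis `CHART`), the two endpoints of every frozen OPEN
edge of the jump collar carry the same prescribed level, hence `openFactor` is consistent in every
height configuration: frozen open edges are never cuts. [folklore] -/
theorem s13_openEdgeLevels : ∀ (ι : Literature.Probability.LatticeModels.CollarLegModel.LegInsertionData) (V : Finset (ℤ × ℤ)), ι.IsAdmissible V → (∀ x ∈ insert ι.sink ι.source, ∃ dvec : ℤ × ℤ, (dvec = (1, 0) ∨ dvec = (-1, 0) ∨ dvec = (0, 1) ∨ dvec = (0, -1)) ∧ ∀ v : ℤ × ℤ, (v.1 - x.1) ^ 2 + (v.2 - x.2) ^ 2 ≤ ((ι.sinkLegs : ℤ) + 3) ^ 2 → (v ∈ V ↔ 0 ≤ (v.1 - x.1) * dvec.1 + (v.2 - x.2) * dvec.2)) → (∀ u ∈ V, ∀ k : Fin 4, u + Literature.Probability.LatticeModels.CollarLegModel.dir k ∉ V → ∃ (K : Fin 4) (c₁ c₂ : ℤ), (∀ v : ℤ × ℤ, |v.1 - u.1| ≤ 3 → |v.2 - u.2| ≤ 3 → (v ∈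 V ↔ c₂ ≤ v.1 * (Literature.Probability.LatticeModels.CollarLegModel.dir (K + 1)).1 + v.2 * (Literature.Probability.LatticeModels.CollarLegModel.dir (K + 1)).2)) ∨ (∀ v : ℤ × ℤ, |v.1 - u.1| ≤ 3 → |v.2 - u.2| ≤ 3 → (v ∈ V ↔ c₁ ≤ v.1 * (Literature.Probability.LatticeModels.CollarLegModel.dir K).1 + v.2 * (Literature.Probability.LatticeModels.CollarLegModel.dir K).2 ∧ c₂ ≤ v.1 * (Literature.Probability.LatticeModels.CollarLegModel.dir (K + 1)).1 + v.2 * (Literature.Probability.LatticeModels.CollarLegModel.dir (K + 1)).2)) ∨ (∀ v : ℤ × ℤ, |v.1 - u.1| ≤ 3 → |v.2 - u.2| ≤ 3 → (v ∈ V ↔ c₂ ≤ v.1 * (Literature.Probability.LatticeModels.CollarLegModel.dir (K + 1)).1 + v.2 * (Literature.Probability.LatticeModels.CollarLegModel.dir (K + 1)).2 ∨ v.1 * (Literature.Probability.LatticeModels.CollarLegModel.dir K).1 + v.2 * (Literature.Probability.LatticeModels.CollarLegModel.dir K).2 ≤ c₁))) → ∀ e ∈ (Literature.Probability.LatticeModels.CollarLegModel.LegInsertionData.model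 ι V).openEdges, (Literature.Probability.LatticeModels.CollarLegModel.LegInsertionData.model ι V).C.vertH e.1 = (Literature.Probability.LatticeModels.CollarLegModel.LegInsertionData.model ι V).C.vertH (Literature.Probability.LatticeModels.SixVertex.edgeTip e) ∧ ∀ h : ↥(Literature.Probability.LatticeModels.CollarLegModel.LegInsertionData.model ι V).freeCells → ℤ, (Literature.Probability.LatticeModels.CollarLegModel.LegInsertionData.model ι V).hv h e.1 = (Literature.Probability.LatticeModels.CollarLegModel.LegInsertionData.model ι V).hv h (Literature.Probability.LatticeModels.SixVertex.edgeTip e) :=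
  fun ι V hadm hflat hchart e he =>
    ⟨openEdges_vertH_eq ι V hadm hflat hchart he, fun hh => by
      rw [(openEdges_hv_eq _ he hh).1, (openEdges_hv_eq _ he hh).2,
        openEdges_vertH_eq ι V hadm hflat hchart he]⟩

end Summit.CriticalPhenomena.CardyFormulaZ2.Cruxes.BoundaryDefectGaussianR.RainbowMonomialsInExcursionKernels
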